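import Summits.BirchSwinnertonDyer.BirchSwinnertonDyer.Theorems.SemiOrdinaryEisensteinDescentWildKolyvaginUpperAtThreeTowerFree
import Summits.BirchSwinnertonDyer.BirchSwinnertonDyer.Theorems.WildThreeRankOneBSDpOfJetchevMaxOfLiterature
import HarnessLib

/-!
# Route `SemiOrdinaryEisensteinDescent`, crux Ko `WildKolyvaginUpperAtThree` (stmt-BirchSwinnertonDyer-20480):
# the PRINT-CLOSED SUB-CELLS of Ko, and Ko BY NAME from the Σ-form on MULTI-CARRIER frames only
# (cell `bsd-wall`, width seat `bsd-wall-soed-p2-w2` gen 4; `--supports stmt-BirchSwinnertonDyer-20480`)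

Ko asks, on every Heegner frame `(W, N, K, Dt, H, ι, P)` of the onto wild rank-one row at `3` (`ClassO6 W 3`,
`ρ̄_{E,3}` onto, `r_an = 1`, `N = N_E`, `K` imaginary quadratic Heegner for `N`, `L(E^{d_K},1) ≠ 0`, `P = y_K`
non-torsion, `d_K` odd, `d_K ≠ −3`, `3`-adic tower), the Kolyvagin-side socket
`SchneiderFree.Upper.IndexUpperBoundLeAt W 3 K P (v₃ c(Dt))`, i.e.
`ord₃ #Ш(E/K) + 2·ord₃ ∏_q c_q(E) + 2·v₃ c(Dt) ≤ 2·ord₃ [E(K) : ℤP]`. Write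
`t := ord₃ ∏_q c_q(E) + v₃ c(Dt)` (the DEPTH the research child J = `WildSigmaDivisibilityAtThree`,
stmt-BirchSwinnertonDyer-20760, must reach: `3^{s'} ∣ P_n` for all `s' ≤ t`). The line `birth` (v4, w2 g3)
composes Ko ⟸ J + {`casselsTate_levelInputs` ∀K, `GrossLMS1991.prop37_2_frobeniusCongruence`,
`Gross1991_heegnerPoint_sub_ratTorsion_mem_E0`} (p591367 / p594241). This file records WHICH FRAMES need J at all:

* §1 `koTowerFree_of_depthZero_of_threePrimitives` — **zero-depth sub-cell** (`t = 0`: `3 ∤ c(Dt)·∏_q c_q(E)`):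
  the socket (even WITHOUT the tower binder, Ko′ of p594241 §3) follows from the three primitives ALONE — the
  global-divisibility hypothesis of w2 g3's receptacle `upper_of_globalDivisibility_of_threePrimitives_modP` is
  asked only to depth `0`, where `Koly.PDiv d 3 0` («`3^0 ∣ P_n`») is free. Variant `…_of_not_dvd_…` with the
  hypothesis spelled `¬ 3 ∣ ∏ c_q ∧ ¬ 3 ∣ c`. (Kolyvagin 1990 / McCallum Cor. 5.6 at `t = 0`, tower-free.)
* §2 `ko_of_singleCarrier_of_fourPrimitives` — **single-carrier sub-cell** (`t ≤ ord₃ c_{q₀}(E)` for ONE prime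
  `q₀ ∣ N`; e.g. `q₀ = 3`, Kodaira IV/IV*, `c₃ = 3`, every other `c_q` and `c` prime to `3`): the socket follows
  from the three primitives + (PT) `poitouTate_selmerStructure_duality_conj` (∀ `K`), through utd-p3 g3's
  `SchneiderFree.Exact.jetchevMaxAtThree_of_literature` (p570933 §1: Jetchev 2008 Thm. 1.4 at `3 ∣ N`, the `bsd-jet`
  road-K kernel fed by (PT), (F1) = E0, (3.7)) and `globalDivisibility_of_jetchevMax_of_singleCarrier`. This is
  w3 g0's `indexUpperBoundLeAt_of_singleCarrier_of_literature` (p579505) RE-KEYED from {Kolyvagin Thm. A,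
  Matar–Nekovář Thm. 0.7} to {`casselsTate_levelInputs`}: Kolyvagin's Thm. A was ELIMINATED from Ko's composition
  (w2 g2: Gross 8.2 discharged p589739, rank one from {3.7, E0} p590255) and McCallum's Cor. 5.6 upper half is
  DERIVED from {CT, 3.7, E0} (bsd-stepL; tower-free by w2 g3 p594241 §1). FOUR named print statements, no
  structure theorem by name.
* §3 `wildKolyvaginUpperAtThree_of_sigmaMultiCarrier_of_fourPrimitives` — **Ko BY NAME ⟸ the four primitives +
  J restricted to MULTI-CARRIER frames** (`hJm`: J's text VERBATIM with ONE extra binder «no single prime `q ∣ N`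
  carries the depth: `∀ q ∣ N, ord₃ c_q(E) < t`»). So the research stub of line `birth` is load-bearing EXACTLY
  on the frames with at least two `3`-carriers among {`c_q(E)` : `q ∣ N`} ∪ {`c(Dt)`} — the habitat that census
  T17 calls the JET-PRODUCT residue (3 413 classes) plus the Manin-carrier frames — and nowhere else: every other
  frame of Ko is closed by print. (Büyükboduk 2009 §4.2 Question 1 is precisely the multi-carrier peeling.)
  The tower-free twin (Ko′ of w2 g3 from J′ on multi-carrier frames) is NOT claimed: the `bsd-jet` kernel behind §2
  takes the `3`-adic tower as a binder, so off the tower only the zero-depth sub-cell (§1) is print-closed here.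

HONEST FRAMING. CONDITIONAL theorems: the four primitives are Literature named facts (hypotheses, not
discharged: local/global duality, Cassels–Tate at level `p^{M₀}`, the Eichler–Shimura congruence for Heegner
points, GZ86 III (3.1)); `hJm` is open research (Jetchev 2008 Conj. 1.3 «≥» / W. Zhang's refined Kolyvagin
conjecture at the ADDITIVE prime `3` on multi-carrier frames; no printed mechanism). Nothing about any curve is
asserted; no definition, no named fact, no `sorry`; Ko, J and BSD stay open. BSD is not proved by this file.

References: [Jetchev2008] Thm. 1.4, Cor. 1.5, Conj. 1.3 (arXiv:math/0703431 p. 3), Prop. 4.9, Thm. 6.3;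
[McCallumLMS1991] §5 Lemma 5.1 (p. 303), Cor. 5.6 (p. 310); [GrossLMS1991] Prop. 3.7 (2), §6, §9;
[Buyukboduk2009TamagawaDefect] §4.2 Question 1 (arXiv:0710.3858); [MilneADT2006] I Thm. 4.10, I §6 Thm. 6.13;
[GrossZagier1986] III (3.1).
-/

set_option autoImplicit false
set_option linter.dupNamespace false -- `Summit.BirchSwinnertonDyer.BirchSwinnertonDyer.…` is the tree's layout (D-0017)

noncomputable section

open scoped Classical

namespace Summit.BirchSwinnertonDyer.BirchSwinnertonDyer.Theorems.WildKolyvaginUpperAtThreePrintClosedSubcells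

open WeierstrassCurve NumberField
  Literature.NumberTheory.EllipticCurves
  Literature.NumberTheory.EllipticCurves.ModularForms
  Literature.NumberTheory.GaloisCohomology
  Summit.BirchSwinnertonDyer.Rank1Residual
  Summit.BirchSwinnertonDyer.Rank1Residual.Additive
  Summit.BirchSwinnertonDyer.Rank1Residual.X11b.Three
  Summit.BirchSwinnertonDyer.BirchSwinnertonDyer.Theses.SemiOrdinaryEisensteinDescent
  Summit.BirchSwinnertonDyer.BirchSwinnertonDyer.Theorems.SchneiderFree
  Summit.BirchSwinnertonDyer.BirchSwinnertonDyer.Theorems.WildKolyvaginUpperAtThreeTowerFree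
open Literature.NumberTheory.EllipticCurves.GrossLMS1991 (prop37_2_frobeniusCongruence)

/-! ## §1 The zero-depth sub-cell: `3 ∤ c(Dt)·∏ c_q` — three primitives, NO Σ-form, NO tower -/

/-- **Ko′ on the ZERO-DEPTH sub-cell from the three primitives alone.** On a Heegner frame of the onto wild
rank-one row at `3` WITHOUT the tower binder (`W` globally minimal, `ρ̄_{E,3}` onto, `K` imaginary quadratic Heegner
for `N_E` with `d_K` odd, `d_K ≠ −3`, `P = y_K` of the datum `(Dt, H, ι)` non-torsion) whose depth
`t = ord₃ ∏_q c_q(E) + v₃ c(Dt)` is ZERO, the socket `Upper.IndexUpperBoundLeAt W 3 K P (v₃ c(Dt))` holds GIVEN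
{`casselsTate_levelInputs` (∀ `K`), Gross 1991 Prop. 3.7 (2), GZ86 III (3.1) = `Gross1991_heegnerPoint_sub_ratTorsion_mem_E0`}:
w2 g3's receptacle `upper_of_globalDivisibility_of_threePrimitives_modP` asks global divisibility only to depth
`t = 0`, and `3^0 ∣ P_n` (`Koly.PDiv d 3 0`) holds for every derived Heegner point. No `ClassO6`, no `r_an = 1`, no
`L(E^{d_K},1) ≠ 0` is used (they are not binders here). CONDITIONAL on the three named facts; per frame.
[cite: McCallumLMS1991, §5 Cor. 5.6 (p. 310) and Lemma 5.1 (p. 303)] [cite: GrossLMS1991, §2 Prop. 2.1, §3 Prop. 3.7 (2)]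
[cite: GrossZagier1986, III (3.1)] -/
theorem koTowerFree_of_depthZero_of_threePrimitives
    (hCT : ∀ (K : Type) [Field K] [NumberField K], casselsTate_levelInputs K)
    (h372 : prop37_2_frobeniusCongruence) (hE0 : Gross1991_heegnerPoint_sub_ratTorsion_mem_E0)
    (W : WeierstrassCurve ℚ) [W.IsElliptic] [W.IsGloballyMinimal] (N : ℕ) [NeZero N] (K : Type)
    [Field K] [NumberField K] (Dt : ModularParametrizationData W N)
    (H : HeegnerDatum N (NumberField.discr K)) (ι : K →+* ℂ) (P : (W.baseChange K).toAffine.Point)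
    (hsurj : W.HasSurjectiveModNGaloisRep 3) (hN : W.conductorNorm ℤ = N) (hK : IsImaginaryQuadratic K)
    (hHH : SatisfiesHeegnerHypothesis N K)
    (hP : WeierstrassCurve.Affine.Point.map ι.toRatAlgHom P = heegnerPointComplex Dt H)
    (hnt : ¬ IsOfFinAddOrder P) (hodd : Odd (NumberField.discr K)) (h3 : NumberField.discr K ≠ -3)
    (ht0 : padicValNat 3 W.tamagawaProduct + padicValNat 3 Dt.c.natAbs = 0) :
    Upper.IndexUpperBoundLeAt W 3 K P (padicValNat 3 Dt.c.natAbs) := by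
  subst hN
  haveI : Fact (Nat.Prime 3) := ⟨Nat.prime_three⟩
  have hD : NumberField.discr K < -4 :=
    WildKolyvaginUpperAtThreeOfMinftyGe.discr_lt_neg_four_of_odd hK hodd h3 H.dvd_sq_sub
  have h4 : NumberField.discr K ≠ -4 := by omega
  refine upper_of_globalDivisibility_of_threePrimitives_modP hCT h372 hE0 W 3 (by decide) hsurj K hK h3 h4 hHH
    Dt H ι P hP hnt ?_
  intro s' hs' n d _hn _hℓ
  have hs0 : s' = 0 := by omega
  subst hs0
  exact ⟨d.derivedPoint, by rw [pow_zero, Nat.cast_one, one_zsmul]⟩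

/-- **The zero-depth sub-cell, divisibility spelling**: the same with `t = 0` written as `3 ∤ ∏_q c_q(E)` and
`3 ∤ c(Dt)`. [cite: McCallumLMS1991, §5 Cor. 5.6 (p. 310)] [cite: GrossLMS1991, §3 Prop. 3.7 (2)] -/
theorem koTowerFree_of_not_dvd_of_threePrimitives
    (hCT : ∀ (K : Type) [Field K] [NumberField K], casselsTate_levelInputs K)
    (h372 : prop37_2_frobeniusCongruence) (hE0 : Gross1991_heegnerPoint_sub_ratTorsion_mem_E0)
    (W : WeierstrassCurve ℚ) [W.IsElliptic] [W.IsGloballyMinimal] (N : ℕ) [NeZero N] (K : Type)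
    [Field K] [NumberField K] (Dt : ModularParametrizationData W N)
    (H : HeegnerDatum N (NumberField.discr K)) (ι : K →+* ℂ) (P : (W.baseChange K).toAffine.Point)
    (hsurj : W.HasSurjectiveModNGaloisRep 3) (hN : W.conductorNorm ℤ = N) (hK : IsImaginaryQuadratic K)
    (hHH : SatisfiesHeegnerHypothesis N K)
    (hP : WeierstrassCurve.Affine.Point.map ι.toRatAlgHom P = heegnerPointComplex Dt H)
    (hnt : ¬ IsOfFinAddOrder P) (hodd : Odd (NumberField.discr K)) (h3 : NumberField.discr K ≠ -3)
    (htam : ¬ 3 ∣ W.tamagawaProduct) (hc : ¬ 3 ∣ Dt.c.natAbs) :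
    Upper.IndexUpperBoundLeAt W 3 K P (padicValNat 3 Dt.c.natAbs) :=
  koTowerFree_of_depthZero_of_threePrimitives hCT h372 hE0 W N K Dt H ι P hsurj hN hK hHH hP hnt hodd h3
    (by rw [padicValNat.eq_zero_of_not_dvd htam, padicValNat.eq_zero_of_not_dvd hc])

/-! ## §2 The single-carrier sub-cell: `t ≤ ord₃ c_{q₀}` — four primitives, NO Σ-form -/

/-- **Ko on the SINGLE-CARRIER sub-cell from four named print statements.** Under the binders of crux Ko
(`ClassO6 W 3`, `ρ̄₃` onto, `r_an = 1`, `N = N_E`, `K` imaginary quadratic Heegner for `N`, `L(E^{d_K},1) ≠ 0`,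
`P = y_K` of `(Dt, H, ι)` non-torsion, `d_K` odd, `d_K ≠ −3`, `TowerSurjThree W`) and ONE extra hypothesis — a prime
`q₀ ∣ N` carries the whole depth: `ord₃ ∏_q c_q(E) + v₃ c(Dt) ≤ ord₃ c_{q₀}(E)` (`hcar`) — the socket
`Upper.IndexUpperBoundLeAt W 3 K P (v₃ c(Dt))` holds GIVEN {`casselsTate_levelInputs` (∀ `K`), Gross 3.7 (2), GZ86
III (3.1)} + (PT) `poitouTate_selmerStructure_duality_conj` (∀ `K`). Proof: Jetchev's Thm. 1.4 at `3 ∣ N`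
(`SchneiderFree.Exact.jetchevMaxAtThree_of_literature`, from (PT), (F1) = E0, (3.7)) gives `3^{s'} ∣ P_n` to depth
`ord₃ c_{q₀}`, hence (`hcar`, `globalDivisibility_of_jetchevMax_of_singleCarrier`) to depth `t`; the three-primitive
receptacle at the mod-`3` image (`upper_of_globalDivisibility_of_threePrimitives_modP`: McCallum Cor. 5.6 DERIVED
from {CT, 3.7, E0}, rank one from {3.7, E0}) turns that into the socket. w3 g0's p579505 re-keyed: no Kolyvagin
Thm. A, no Matar–Nekovář 0.7 by name. CONDITIONAL on the four named facts; per frame.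
[cite: Jetchev2008, Thm. 1.4 and Cor. 1.5 (arXiv:math/0703431 p. 3)] [cite: McCallumLMS1991, §5 Cor. 5.6 (p. 310)]
[cite: MilneADT2006, Ch. I Thm. 4.10 and §6 Thm. 6.13(a)] [cite: GrossLMS1991, §3 Prop. 3.7 (2)] -/
theorem ko_of_singleCarrier_of_fourPrimitives
    (hCT : ∀ (K : Type) [Field K] [NumberField K], casselsTate_levelInputs K)
    (h372 : prop37_2_frobeniusCongruence) (hE0 : Gross1991_heegnerPoint_sub_ratTorsion_mem_E0)
    (hPT : ∀ (K : Type) [Field K] [NumberField K], poitouTate_selmerStructure_duality_conj K)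
    (W : WeierstrassCurve ℚ) [W.IsElliptic] [W.IsGloballyMinimal] (N : ℕ) [NeZero N] (K : Type)
    [Field K] [NumberField K] (Dt : ModularParametrizationData W N)
    (H : HeegnerDatum N (NumberField.discr K)) (ι : K →+* ℂ) (P : (W.baseChange K).toAffine.Point)
    (hO6 : ClassO6 W 3) (hsurj : W.HasSurjectiveModNGaloisRep 3) (hr : W.analyticRank = 1)
    (hN : W.conductorNorm ℤ = N) (hK : IsImaginaryQuadratic K) (hHH : SatisfiesHeegnerHypothesis N K)
    (hLd : (W.quadraticTwist (NumberField.discr K : ℚ)).entireLFunction 1 ≠ 0)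
    (hP : WeierstrassCurve.Affine.Point.map ι.toRatAlgHom P = heegnerPointComplex Dt H)
    (hnt : ¬ IsOfFinAddOrder P) (hodd : Odd (NumberField.discr K)) (h3 : NumberField.discr K ≠ -3)
    (htow : AdditiveThree.TowerSurjThree W)
    {q₀ : ℕ} [Fact q₀.Prime] (hq₀ : q₀ ∣ N)
    (hcar : padicValNat 3 W.tamagawaProduct + padicValNat 3 Dt.c.natAbs ≤
      padicValNat 3 ((W.baseChange ℚ_[q₀]).localTamagawaNumber ℤ_[q₀])) :
    Upper.IndexUpperBoundLeAt W 3 K P (padicValNat 3 Dt.c.natAbs) := by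
  subst hN
  haveI : Fact (Nat.Prime 3) := ⟨Nat.prime_three⟩
  have hD : NumberField.discr K < -4 :=
    WildKolyvaginUpperAtThreeOfMinftyGe.discr_lt_neg_four_of_odd hK hodd h3 H.dvd_sq_sub
  have h4 : NumberField.discr K ≠ -4 := by omega
  -- Jetchev Thm. 1.4 at `3 ∣ N` on this frame (max-form, every carrier), from (PT), (F1), (3.7)
  have hJmax := Exact.jetchevMaxAtThree_of_literature hPT hE0 h372 W (W.conductorNorm ℤ) K Dt H ι P hO6
    hsurj hr rfl hK hHH hLd hP hnt hodd h3 htow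
  -- single carrier: max-form ⟹ Σ-form on this frame
  have hglob := Exact.globalDivisibility_of_jetchevMax_of_singleCarrier (p := 3) hJmax hq₀ hcar
  -- the three-primitive receptacle at the mod-`3` image
  exact upper_of_globalDivisibility_of_threePrimitives_modP hCT h372 hE0 W 3 (by decide) hsurj K hK h3 h4 hHH
    Dt H ι P hP hnt hglob

/-! ## §3 Ko BY NAME ⟸ the four primitives + the Σ-form on MULTI-CARRIER frames only -/

/-- **Ko BY NAME from the four primitives and J restricted to MULTI-CARRIER frames.** `hJm` is the text of
J = `WildSigmaDivisibilityAtThree` (stmt-BirchSwinnertonDyer-20760) VERBATIM with ONE extra binder inserted after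
the tower: «no single prime `q ∣ N` carries the depth», `∀ q ∣ N, ord₃ c_q(E) < ord₃ ∏ c_q(E) + v₃ c(Dt)` — i.e. J is
asked ONLY on frames with at least two `3`-carriers among the `c_q(E)` (`q ∣ N`) and `c(Dt)`. Every other frame of Ko
is a single-carrier frame (some `q₀ ∣ N` with `t ≤ ord₃ c_{q₀}`; this includes `t = 0`, as `3 ∣ N`) and is closed
by §2. CONDITIONAL on the four named facts and on `hJm` (open research: Büyükboduk 2009 §4.2 Question 1 — the
multi-carrier peeling — ⊕ the Manin₃ carrier); Ko, J and BSD stay open.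
[cite: Jetchev2008, Conj. 1.3, Thm. 1.4 (arXiv:math/0703431 p. 3)] [cite: Buyukboduk2009TamagawaDefect, §4.2 Question 1]
[cite: McCallumLMS1991, §5 Cor. 5.6 (p. 310)] -/
theorem wildKolyvaginUpperAtThree_of_sigmaMultiCarrier_of_fourPrimitives
    (hCT : ∀ (K : Type) [Field K] [NumberField K], casselsTate_levelInputs K)
    (h372 : prop37_2_frobeniusCongruence) (hE0 : Gross1991_heegnerPoint_sub_ratTorsion_mem_E0)
    (hPT : ∀ (K : Type) [Field K] [NumberField K], poitouTate_selmerStructure_duality_conj K)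
    (hJm : ∀ (W : WeierstrassCurve ℚ) [W.IsElliptic] [W.IsGloballyMinimal] (N : ℕ) [NeZero N] (K : Type)
      [Field K] [NumberField K] (Dt : ModularParametrizationData W N)
      (H : HeegnerDatum N (NumberField.discr K)) (ι : K →+* ℂ) (P : (W.baseChange K).toAffine.Point),
      ClassO6 W 3 → W.HasSurjectiveModNGaloisRep 3 → W.analyticRank = 1 → W.conductorNorm ℤ = N →
      IsImaginaryQuadratic K → SatisfiesHeegnerHypothesis N K →
      (W.quadraticTwist (NumberField.discr K : ℚ)).entireLFunction 1 ≠ 0 →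
      WeierstrassCurve.Affine.Point.map ι.toRatAlgHom P = heegnerPointComplex Dt H →
      ¬ IsOfFinAddOrder P → Odd (NumberField.discr K) → NumberField.discr K ≠ -3 →
      AdditiveThree.TowerSurjThree W →
      (∀ (q : ℕ) [Fact q.Prime], q ∣ N →
        padicValNat 3 ((W.baseChange ℚ_[q]).localTamagawaNumber ℤ_[q]) <
          padicValNat 3 W.tamagawaProduct + padicValNat 3 Dt.c.natAbs) →
      ∀ (s' : ℕ), s' ≤ padicValNat 3 W.tamagawaProduct + padicValNat 3 Dt.c.natAbs →
        ∀ (n : ℕ) (d : KolyvaginHeegnerData Dt H.β ι n), Squarefree n →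
          (∀ ℓ ∈ n.primeFactors, Zhang2014.IsKolyvaginPrime N W K 3 ℓ ∧
            s' ≤ Zhang2014.kolyvaginIndex W 3 ℓ) → Koly.PDiv d 3 s') :
    WildKolyvaginUpperAtThree := by
  intro W _ _ N _ K _ _ Dt H ι P hO6 hsurj hr hN hK hHH hLd hP hnt hodd h3 htow
  by_cases hm : ∀ (q : ℕ) [Fact q.Prime], q ∣ N →
      padicValNat 3 ((W.baseChange ℚ_[q]).localTamagawaNumber ℤ_[q]) <
        padicValNat 3 W.tamagawaProduct + padicValNat 3 Dt.c.natAbs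
  · -- multi-carrier frame: the Σ-form `hJm` feeds the three-primitive receptacle (tower road, p591367)
    have hglob := hJm W N K Dt H ι P hO6 hsurj hr hN hK hHH hLd hP hnt hodd h3 htow hm
    subst hN
    haveI : Fact (Nat.Prime 3) := ⟨Nat.prime_three⟩
    have hD : NumberField.discr K < -4 :=
      WildKolyvaginUpperAtThreeOfMinftyGe.discr_lt_neg_four_of_odd hK hodd h3 H.dvd_sq_sub
    have h4 : NumberField.discr K ≠ -4 := by omega
    exact upper_of_globalDivisibility_of_threePrimitives_modP hCT h372 hE0 W 3 (by decide) hsurj K hK h3 h4 hHH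
      Dt H ι P hP hnt hglob
  · -- single-carrier frame: §2
    push Not at hm
    obtain ⟨q₀, hq₀, hq₀N, hcar⟩ := hm
    exact ko_of_singleCarrier_of_fourPrimitives hCT h372 hE0 hPT W N K Dt H ι P hO6 hsurj hr hN hK hHH hLd hP
      hnt hodd h3 htow hq₀N hcar

end Summit.BirchSwinnertonDyer.BirchSwinnertonDyer.Theorems.WildKolyvaginUpperAtThreePrintClosedSubcells

end
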